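/-
Soloist artefact (solo-KontsevichZagierPeriods-informed, session s25): the EXTENSION MODEL `𝒟_d`,
part 2.  References: A. Huber, G. Wüstholz, *Transcendence and linear relations of 1-periods*,
Cambridge Tracts in Math. 227 (2022), Def. 7.6, Rem. 7.7, Def. 7.11, Prop. 7.17.
-/
import Summits.KontsevichZagierPeriods.KontsevichZagierPeriods.Theorems.SoloInformedExtensionModel

/-!
# The extension model `𝒟_d` (Proposition VI-ter, part 2): `P̃(𝒟_d) ≅ ℚ[t] ⋉ ℚ(0)`

We identify the space of formal periods of `𝒟_d` (`d ≠ 0`), built verbatim from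
[HW22, Def. 7.6] in `SoloInformedExtensionModel`, with the trivial square-zero extension
`P̃(𝒞_ℕ) ⋉ ℚ(0) = ℚ[t] ⊕ ℚ·η`, `t·η = 0`, `η² = 0`, of the formal period ring `P̃(𝒞_ℕ) ≅ ℚ[t]` of
its semisimplification by the augmentation module `ℚ(0) = ℚ[t]/(t)`:
* `ssMap = P̃(ss) : P̃(𝒟_d) → P̃(𝒞_ℕ)` (induced by the semisimplification functor `X ↦ X^{ss}`,
  which forgets `N`), `etaLin : P̃(𝒟_d) → ℚ` (the coefficient of `η`), and the linear
  isomorphism `efpEquiv : P̃(𝒟_d) ≃ P̃(𝒞_ℕ) ⋉ ℚ(0)`, `⟦(X, σ, ω)⟧ ↦ (⟦(X^{ss}, σ, ω)⟧, ωᵀ N_X σ)`;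
* `η ≠ 0` (`eta_ne_zero`), while `P̃(ss) η = 0` (`ssMap_eta`).
The ring structure (`per · η = 0`, `η² = 0`) is in `SoloInformedExtensionRing`.
-/

noncomputable section

open scoped BigOperators

namespace Summit.KontsevichZagierPeriods.KontsevichZagierPeriods.Theorems

namespace SoloInformedGrObj

/-! ### The augmentation `ev₀ : P̃(𝒞_ℕ) = ℚ[t] → ℚ`, `t ↦ 0` -/

/-- `ℚ[ℕ] → ℚ`, `[n] ↦ 0^n`. -/
def ev0Alg : AddMonoidAlgebra ℚ ℕ →ₐ[ℚ] ℚ :=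
  AddMonoidAlgebra.lift ℚ ℚ ℕ (powersHom ℚ (0 : ℚ))

/-- `ev0Alg (r[n]) = r 0^n`. -/
@[simp] theorem ev0Alg_single (n : ℕ) (r : ℚ) :
    ev0Alg (AddMonoidAlgebra.single n r) = r * (0 : ℚ) ^ n := by
  rw [ev0Alg, AddMonoidAlgebra.lift_single, powersHom_apply, toAdd_ofAdd, smul_eq_mul]

/-- The augmentation `ev₀ : P̃(𝒞_ℕ) → ℚ` (the constant coefficient of `ℚ[t]`). -/
def ev0 : FP ℕ →+* ℚ := ev0Alg.toRingHom.comp (fpRingEquiv (G := ℕ)).toRingHom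

/-- `ev₀ = ev0Alg ∘ fpEquiv`. -/
theorem ev0_apply (y : FP ℕ) : ev0 y = ev0Alg (fpEquiv y) := rfl

/-- `ev₀ (p_n) = [n = 0]`. -/
@[simp] theorem ev0_gen (n : ℕ) : ev0 (gen n) = if n = 0 then 1 else 0 := by
  rw [ev0_apply, fpEquiv_gen, ev0Alg_single, one_mul, zero_pow_eq]

/-- `ev₀` is `ℚ`-linear. -/
theorem ev0_smul (q : ℚ) (y : FP ℕ) : ev0 (q • y) = q * ev0 y := by
  rw [ev0_apply, ev0_apply, map_smul, map_smul, smul_eq_mul]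

/-- `ev₀ ⟦(X, σ, ω)⟧ = ∑_{deg b = 0} σ_b ω_b` (the degree-`0` matrix coefficient). -/
theorem ev0_cls (X : SoloInformedGrObj ℕ) (σ ω : X.B → ℚ) :
    ev0 (cls X σ ω) = ∑ b, σ b * ω b * (if X.deg b = 0 then 1 else 0) := by
  rw [cls_eq_sum, map_sum]
  refine Finset.sum_congr rfl fun b _ => ?_
  rw [map_rat_smul, ev0_gen, smul_eq_mul]

end SoloInformedGrObj

namespace SoloInformedExtObj

open SoloInformedGrObj

variable {d : ℕ}

/-! ### `P̃` of the semisimplification functor, and the `η`-coefficient -/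

/-- `P̃(ss)` on the free module: `(X, σ, ω) ↦ ⟦(X^{ss}, σ, ω)⟧ ∈ P̃(𝒞_ℕ)`. -/
def ssMap₀ : FreeE d →ₗ[ℚ] FP ℕ :=
  Finsupp.linearCombination ℚ (fun s : SymE d => cls s.1.gr s.2.1 s.2.2)

/-- `ssMap₀` on a symbol. -/
theorem ssMap₀_fsymE (X : SoloInformedExtObj d) (σ ω : X.gr.B → ℚ) :
    ssMap₀ (fsymE X σ ω) = cls X.gr σ ω := by
  simp [ssMap₀, fsymE, mkSymE, Finsupp.linearCombination_single]

/-- The relations of `𝒟_d` map to relations of `𝒞_ℕ` (an `EHom` is in particular graded). -/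
theorem relE_le_ker_ssMap₀ : RelE d ≤ LinearMap.ker (ssMap₀ (d := d)) := by
  unfold RelE
  rw [Submodule.span_le]
  rintro v ((((⟨X, σ₁, σ₂, ω, rfl⟩ | ⟨X, a, σ, ω, rfl⟩) | ⟨X, σ, ω₁, ω₂, rfl⟩) | ⟨X, a, σ, ω, rfl⟩) |
    ⟨X, Y, g, σ, ω, rfl⟩)
  · simp [ssMap₀_fsymE, cls_add_left]
  · simp [ssMap₀_fsymE, cls_smul_left]
  · simp [ssMap₀_fsymE, cls_add_right]
  · simp [ssMap₀_fsymE, cls_smul_right]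
  · simp [ssMap₀_fsymE, cls_functorial]

/-- `P̃(ss) : P̃(𝒟_d) → P̃(𝒞_ℕ)`, induced by the semisimplification functor. -/
def ssMap : EFP d →ₗ[ℚ] FP ℕ := (RelE d).liftQ ssMap₀ relE_le_ker_ssMap₀

/-- `P̃(ss) ⟦(X, σ, ω)⟧ = ⟦(X^{ss}, σ, ω)⟧`. -/
@[simp] theorem ssMap_clsE (X : SoloInformedExtObj d) (σ ω : X.gr.B → ℚ) :
    ssMap (clsE X σ ω) = cls X.gr σ ω := by
  simp [ssMap, clsE, Submodule.liftQ_apply, ssMap₀_fsymE]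

/-- `P̃(ss) p_n = p_n`. -/
@[simp] theorem ssMap_genE (n : ℕ) : ssMap (genE n : EFP d) = gen n := ssMap_clsE _ _ _

/-- `P̃(ss) η = 0`: the extension period is invisible on the semisimplification. -/
@[simp] theorem ssMap_eta : ssMap (eta : EFP d) = 0 := by
  rw [eta, ssMap_clsE, cls_eq_sum]
  simp [kTop, kBot]

/-- The `η`-coefficient is additive in `σ`. -/
theorem etaCoef_add_left (X : SoloInformedExtObj d) (σ₁ σ₂ ω : X.gr.B → ℚ) :
    etaCoef X (σ₁ + σ₂) ω = etaCoef X σ₁ ω + etaCoef X σ₂ ω := by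
  simp [etaCoef, mul_add, Finset.sum_add_distrib]

/-- … homogeneous in `σ`. -/
theorem etaCoef_smul_left (X : SoloInformedExtObj d) (a : ℚ) (σ ω : X.gr.B → ℚ) :
    etaCoef X (a • σ) ω = a * etaCoef X σ ω := by
  simp [etaCoef, Finset.mul_sum, mul_left_comm, mul_assoc, mul_comm]

/-- … additive in `ω`. -/
theorem etaCoef_add_right (X : SoloInformedExtObj d) (σ ω₁ ω₂ : X.gr.B → ℚ) :
    etaCoef X σ (ω₁ + ω₂) = etaCoef X σ ω₁ + etaCoef X σ ω₂ := by
  simp [etaCoef, add_mul, Finset.sum_add_distrib]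

/-- … homogeneous in `ω`. -/
theorem etaCoef_smul_right (X : SoloInformedExtObj d) (a : ℚ) (σ ω : X.gr.B → ℚ) :
    etaCoef X σ (a • ω) = a * etaCoef X σ ω := by
  simp [etaCoef, Finset.mul_sum, mul_assoc]

/-- … and FUNCTORIAL in `EHom` (this is where `f N_X = N_Y f` is used). -/
theorem etaCoef_functorial {X Y : SoloInformedExtObj d} (g : EHom X Y) (σ : X.gr.B → ℚ)
    (ω : Y.gr.B → ℚ) : etaCoef X σ (g.f.pull ω) = etaCoef Y (g.f.push σ) ω := by
  have hL : etaCoef X σ (g.f.pull ω) =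
      ∑ b, ∑ y, ω y * σ b * ∑ x, g.f.mat y x * X.nmat x b := by
    simp only [etaCoef, Hom.pull, Finset.sum_mul, Finset.mul_sum]
    refine Finset.sum_congr rfl fun b _ => ?_
    rw [Finset.sum_comm]
    exact Finset.sum_congr rfl fun y _ => Finset.sum_congr rfl fun x _ => by ring
  have hR : etaCoef Y (g.f.push σ) ω =
      ∑ b, ∑ y, ω y * σ b * ∑ y', Y.nmat y y' * g.f.mat y' b := by
    simp only [etaCoef, Hom.push]
    calc ∑ b', ∑ y, ω y * Y.nmat y b' * ∑ b, g.f.mat b' b * σ b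
        = ∑ b', ∑ y, ∑ b, ω y * σ b * (Y.nmat y b' * g.f.mat b' b) := by
          refine Finset.sum_congr rfl fun b' _ => Finset.sum_congr rfl fun y _ => ?_
          rw [Finset.mul_sum]
          exact Finset.sum_congr rfl fun b _ => by ring
      _ = ∑ b', ∑ b, ∑ y, ω y * σ b * (Y.nmat y b' * g.f.mat b' b) :=
          Finset.sum_congr rfl fun _ _ => Finset.sum_comm
      _ = ∑ b, ∑ b', ∑ y, ω y * σ b * (Y.nmat y b' * g.f.mat b' b) := Finset.sum_comm
      _ = ∑ b, ∑ y, ∑ b', ω y * σ b * (Y.nmat y b' * g.f.mat b' b) :=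
          Finset.sum_congr rfl fun _ _ => Finset.sum_comm
      _ = ∑ b, ∑ y, ω y * σ b * ∑ y', Y.nmat y y' * g.f.mat y' b := by
          simp only [Finset.mul_sum]
  rw [hL, hR]
  exact Finset.sum_congr rfl fun b _ => Finset.sum_congr rfl fun y _ => by rw [g.comm y b]

/-- The `η`-coefficient on the free module. -/
def etaLin₀ : FreeE d →ₗ[ℚ] ℚ :=
  Finsupp.linearCombination ℚ (fun s : SymE d => etaCoef s.1 s.2.1 s.2.2)

/-- `etaLin₀` on a symbol. -/
theorem etaLin₀_fsymE (X : SoloInformedExtObj d) (σ ω : X.gr.B → ℚ) :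
    etaLin₀ (fsymE X σ ω) = etaCoef X σ ω := by
  simp [etaLin₀, fsymE, mkSymE, Finsupp.linearCombination_single]

/-- The relations lie in the kernel of `etaLin₀`. -/
theorem relE_le_ker_etaLin₀ : RelE d ≤ LinearMap.ker (etaLin₀ (d := d)) := by
  unfold RelE
  rw [Submodule.span_le]
  rintro v ((((⟨X, σ₁, σ₂, ω, rfl⟩ | ⟨X, a, σ, ω, rfl⟩) | ⟨X, σ, ω₁, ω₂, rfl⟩) | ⟨X, a, σ, ω, rfl⟩) |
    ⟨X, Y, g, σ, ω, rfl⟩)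
  · simp [etaLin₀_fsymE, etaCoef_add_left]
  · simp [etaLin₀_fsymE, etaCoef_smul_left]
  · simp [etaLin₀_fsymE, etaCoef_add_right]
  · simp [etaLin₀_fsymE, etaCoef_smul_right]
  · simp [etaLin₀_fsymE, etaCoef_functorial]

/-- The `η`-coefficient `P̃(𝒟_d) → ℚ`, `⟦(X, σ, ω)⟧ ↦ ωᵀ N_X σ`. -/
def etaLin : EFP d →ₗ[ℚ] ℚ := (RelE d).liftQ etaLin₀ relE_le_ker_etaLin₀

/-- `etaLin ⟦(X, σ, ω)⟧ = ωᵀ N_X σ`. -/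
@[simp] theorem etaLin_clsE (X : SoloInformedExtObj d) (σ ω : X.gr.B → ℚ) :
    etaLin (clsE X σ ω) = etaCoef X σ ω := by
  simp [etaLin, clsE, Submodule.liftQ_apply, etaLin₀_fsymE]

/-- `etaLin p_n = 0`. -/
@[simp] theorem etaLin_genE (n : ℕ) : etaLin (genE n : EFP d) = 0 := by
  rw [genE, etaLin_clsE]; simp [etaCoef, lineE, ofGr]

/-- `etaLin η = 1`. -/
@[simp] theorem etaLin_eta : etaLin (eta : EFP d) = 1 := by
  rw [eta, etaLin_clsE]; simp [etaCoef, kummer, kTop, kBot]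

/-- The extension period is non-zero. -/
theorem eta_ne_zero : (eta : EFP d) ≠ 0 := by
  intro h
  have h1 := etaLin_eta (d := d)
  rw [h, map_zero] at h1
  exact zero_ne_one h1

/-! ### The model ring `P̃(𝒞_ℕ) ⋉ ℚ(0)` -/

/-- The augmentation module `ℚ(0)`: `ℚ`, on which `P̃(𝒞_ℕ) = ℚ[t]` acts through `ev₀` (`t ↦ 0`). -/
def Aug : Type := ℚ

/-- `ℚ(0)` is an abelian group (that of `ℚ`). -/
instance Aug.instAddCommGroup : AddCommGroup Aug := inferInstanceAs (AddCommGroup ℚ)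

/-- `ℚ(0)` is a `ℚ`-vector space (that of `ℚ`). -/
instance Aug.instModuleRat : Module ℚ Aug := inferInstanceAs (Module ℚ ℚ)

/-- `P̃(𝒞_ℕ)` acts on `ℚ(0)` through `ev₀`. -/
instance Aug.instModuleFP : Module (FP ℕ) Aug := Module.compHom ℚ ev0

/-- The (same) right action. -/
instance Aug.instModuleFPop : Module (FP ℕ)ᵐᵒᵖ Aug :=
  Module.compHom ℚ (ev0.comp (RingEquiv.toOpposite (FP ℕ)).symm.toRingHom)

/-- Left and right actions agree. -/
instance Aug.instCentral : IsCentralScalar (FP ℕ) Aug := ⟨fun _ _ => rfl⟩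

/-- The identification `ℚ(0) = ℚ`. -/
def Aug.toRat : Aug ≃ₗ[ℚ] ℚ := LinearEquiv.refl ℚ ℚ

/-- Unfolding of the action. -/
theorem Aug.smul_def (y : FP ℕ) (a : Aug) : y • a = ev0 y • a := rfl

/-- Unfolding of the right action. -/
theorem Aug.op_smul_def (y : FP ℕ) (a : Aug) : MulOpposite.op y • a = ev0 y • a := rfl

/-- The model ring `P̃(𝒞_ℕ) ⋉ ℚ(0)` (trivial square-zero extension): pairs `(y, a)` with
`(y, a)(y', a') = (yy', ev₀(y) a' + ev₀(y') a)`. -/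
abbrev Model : Type 1 := TrivSqZeroExt (FP ℕ) Aug

/-- `Φ : P̃(𝒟_d) → P̃(𝒞_ℕ) ⋉ ℚ(0)`, `x ↦ (P̃(ss) x, etaLin x)`. -/
def phiE : EFP d →ₗ[ℚ] Model where
  toFun x := (ssMap x, Aug.toRat.symm (etaLin x))
  map_add' x y := Prod.ext (map_add ssMap x y) (by
    change Aug.toRat.symm (etaLin (x + y)) = Aug.toRat.symm (etaLin x) + Aug.toRat.symm (etaLin y)
    rw [map_add, map_add])
  map_smul' q x := Prod.ext (map_smul ssMap q x) (by
    change Aug.toRat.symm (etaLin (q • x)) = q • Aug.toRat.symm (etaLin x)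
    rw [map_smul, map_smul])

/-- First component of `Φ`. -/
@[simp] theorem phiE_fst (x : EFP d) : (phiE x).fst = ssMap x := rfl

/-- Second component of `Φ`. -/
@[simp] theorem phiE_snd (x : EFP d) : Aug.toRat (phiE x).snd = etaLin x := rfl

/-- `p_n ↦ p_n`: the section `P̃(𝒞_ℕ) → P̃(𝒟_d)` on the split part. -/
def liftGen : FP ℕ →ₗ[ℚ] EFP d :=
  (Finsupp.linearCombination ℚ (genE (d := d))) ∘ₗ
    ((AddMonoidAlgebra.coeffLinearEquiv ℚ).toLinearMap ∘ₗ (fpEquiv (G := ℕ)).toLinearMap)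

/-- `liftGen p_n = p_n`. -/
@[simp] theorem liftGen_gen (n : ℕ) : liftGen (gen n) = (genE n : EFP d) := by
  simp [liftGen, Finsupp.linearCombination_single]

/-- `Ψ : P̃(𝒞_ℕ) ⋉ ℚ(0) → P̃(𝒟_d)`, `(y, a) ↦ liftGen y + a η`. -/
def psiE : Model →ₗ[ℚ] EFP d where
  toFun t := liftGen t.fst + Aug.toRat t.snd • eta
  map_add' t t' := by
    simp only [TrivSqZeroExt.fst_add, TrivSqZeroExt.snd_add, map_add, add_smul]; abel
  map_smul' q t := by
    simp only [TrivSqZeroExt.fst_smul, TrivSqZeroExt.snd_smul, map_smul, smul_add, smul_smul,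
      RingHom.id_apply, smul_eq_mul]

/-- Unfolding of `Ψ`. -/
theorem psiE_apply (t : Model) : psiE (d := d) t = liftGen t.fst + Aug.toRat t.snd • eta := rfl

/-- `P̃(ss) ∘ liftGen = id`. -/
theorem ssMap_liftGen (y : FP ℕ) : ssMap (liftGen (d := d) y) = y := by
  have h : ssMap ∘ₗ liftGen (d := d) = LinearMap.id := linearMap_ext fun n => by simp
  exact LinearMap.congr_fun h y

/-- `etaLin ∘ liftGen = 0`. -/
theorem etaLin_liftGen (y : FP ℕ) : etaLin (liftGen (d := d) y) = 0 := by
  have h : etaLin ∘ₗ liftGen (d := d) = 0 := linearMap_ext fun n => by simp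
  exact LinearMap.congr_fun h y

/-- `Φ ∘ Ψ = id`. -/
theorem phiE_psiE (t : Model) : phiE (psiE (d := d) t) = t := by
  refine TrivSqZeroExt.ext ?_ (Aug.toRat.injective ?_)
  · rw [phiE_fst, psiE_apply, map_add, map_smul, ssMap_liftGen, ssMap_eta, smul_zero, add_zero]
  · rw [phiE_snd, psiE_apply, map_add, map_smul, etaLin_liftGen, etaLin_eta, zero_add,
      smul_eq_mul, mul_one]

/-- `Ψ ∘ Φ = id` — i.e. the structure lemma `clsE_eq_sum`. -/
theorem psiE_phiE [NeZero d] (x : EFP d) : psiE (phiE x) = x := by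
  induction x using Submodule.Quotient.induction_on with
  | H v =>
    induction v using Finsupp.induction_linear with
    | zero => simp
    | add a b ha hb =>
      simp only [Submodule.Quotient.mk_add, map_add] at *
      rw [ha, hb]
    | single s r =>
      obtain ⟨X, σ, ω⟩ := s
      have hs : (Finsupp.single (⟨X, (σ, ω)⟩ : SymE d) r : FreeE d) = r • fsymE X σ ω :=
        by rw [fsymE, mkSymE, Finsupp.smul_single', mul_one]
      rw [hs, Submodule.Quotient.mk_smul, map_smul, map_smul]
      change r • psiE (phiE (clsE X σ ω)) = r • clsE X σ ω
      congr 1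
      rw [psiE_apply, phiE_snd, phiE_fst, ssMap_clsE, etaLin_clsE, cls_eq_sum, map_sum,
        clsE_eq_sum]
      congr 1
      refine Finset.sum_congr rfl fun b _ => ?_
      rw [map_smul, liftGen_gen]

/-- `P̃(𝒟_d) ≅ P̃(𝒞_ℕ) ⋉ ℚ(0)` (as `ℚ`-vector spaces; rings: `efpEquiv_mul`). -/
def efpEquiv [NeZero d] : EFP d ≃ₗ[ℚ] Model :=
  LinearEquiv.ofLinear phiE psiE (LinearMap.ext phiE_psiE) (LinearMap.ext psiE_phiE)

/-- `(efpEquiv x).fst = P̃(ss) x`. -/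
@[simp] theorem efpEquiv_fst [NeZero d] (x : EFP d) : (efpEquiv x).fst = ssMap x := rfl

/-- `(efpEquiv x).snd = etaLin x`. -/
@[simp] theorem efpEquiv_snd [NeZero d] (x : EFP d) : Aug.toRat (efpEquiv x).snd = etaLin x := rfl

end SoloInformedExtObj

end Summit.KontsevichZagierPeriods.KontsevichZagierPeriods.Theorems
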